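import Literature.AlgebraicGeometry.Frobenioids.BaseFrobeniusSections
import Literature.AnabelianGeometry.EtaleTheta.BiKummerOfModel
import Literature.AnabelianGeometry.EtaleTheta.Discharge.Sec4Model

/-!
# [EtTh] §4 merge adapter, part 2: the canonical model instance of the bi-Kummer setting

Mochizuki, *The étale theta function and its Frobenioid-theoretic manifestations*, Publ. RIMS **45**
(2009), Def. 4.1, pp. 312–313 (PDF pp. 86–87) [cite: MochizukiEtTh2009, Def 4.1 p.313 (PDF p.87)].
abc-iut cell, layer L2, unit W2-L2-05 (merge adapter t3/found/L1 → t4), seat abc-iut-L2-t9; follows the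
auditor's recommendation F1 of the RQ7 second pass on `BiKummerOfModel.lean` (abc-iut-L2-d2, INBOX
2026-08-25T22:45:31Z): "`mkOfModelCanonical` fixing DS := coprime and ABFP := via `IsBaseFrobeniusPair`,
so that the Prop 4.2/4.3 discharges speak about ONE instance per (tf, Galois data, `A_⊙`)".

`BiKummerSetting.mkOfModel` (`BiKummerOfModel.lean`) fills the five BIRATIONAL fields of abc-iut-L2-t3's
§4 setting from the model Frobenioid and keeps the other inputs as arguments.  Two of those arguments
now have tree vocabulary and are fixed here:

* Def. 4.1 (i) "`Div(s')`, `Div(s'')` have disjoint supports [cf. [FrdI], Proposition 4.1, (iii)]"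
  := the [FrdI] Prop. 4.1 (iii) predicate "every `x ≤ a`, `x ≤ b` is `0`", i.e.
  `∀ x, x ∣ a → x ∣ b → x = 1` (multiplicatively) — the instance for which abc-iut-L6-t12 PROVED
  Prop. 4.2 (i)(ii) (`Discharge/Sec4Model.lean`, `prop42_i_mkOfModel_coprime`, `…_ii_…`);
* Def. 4.1 (iv)(e) "`G, α', α''` arise from a base-Frobenius pair of `C` [cf. Theorem 3.7, (i); [FrdI],
  Proposition 5.6]" := `TemperedFrobenioid.ArisesFromBaseFrobeniusPair`: there is a base-Frobenius pair
  `(P, F)` of `C` ([FrdI] Def. 2.7 (iii), abc-iut-L1-t2's `PreFrobenioid.IsBaseFrobeniusPair`,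
  `Frobenioids/BaseFrobeniusSections.lean`) for which the elements of `G` and `α'` are `P`-distinguished
  and `α''` is `F`-distinguished — [FrdI] Prop. 5.6 (p. 105): the base-Frobenius pair
  `(σ : Aut_D(A_D) ↪ Aut_C(A), φ : ℕ_{≥1} → End_C(A))` "of `A`" is the one "determined by 'restricting'
  `P`, `F` to `A`", so `G ⊆ σ(Aut_D(A_D)) = Aut_P(A)`, `α'' = φ(N) = F(N)_A`, `α' ∈ P`.  (The
  `TODO-merge(abc-iut-L1-t2)` tag on this input in `BiKummerOfModel.lean`'s docstring is thereby stale.)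

`BiKummerSetting.mkOfModelCanonical` is `mkOfModel` with these two inputs fixed and with "`B₀^Λ` is a
group" supplied by the FIELD `RealifiedDivisorMonoids.isUnit_BΛ` of abc-iut-L2-t3's Def. 3.6 (i) data (v2,
p410405); what remains free: Galois objects and `Π^tp_X ↠ Aut_D(−)` ([SemiAnbd],
`TODO-merge(abc-iut-L3-t2)`; canonical only once `D` is `B^temp(Π^tp_X)⁰` concretely), `(N, H)`-saturation
in `C^{bs-fld}` ([FrdII] Def. 2.2 (ii), `TODO-merge(abc-iut-L1-t4)`), and the object `A_⊙`.  (v2 of this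
file, per the audit note L1 of abc-iut-L2-t4, INBOX 2026-08-25T23:32:41Z: `hBΛ` is no longer a parameter.
The coprimality form of "disjoint supports" is equivalent, for perfect perf-factorial `Φ(A)`, to
disjointness of the supports of [FrdI] Def. 2.4 (i)(d):
`Frobenioids.IsPerfFactorial.forall_common_dvd_eq_one_iff_disjoint_supp`, `PerfFactorialCoprime.lean`.)  The Prop. 4.2 (i)(ii) theorems of
`Discharge/Sec4Model.lean` are restated for the canonical instance (`prop42_i_mkOfModelCanonical`,
`prop42_ii_mkOfModelCanonical`: inputs `Φ(A)` perf-factorial in the tree's sense, nothing else).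

HONEST FRAMING: a construction over abc-iut-L2-t3's DATA structure; nothing asserts such data exist for
an actual curve; Def. 4.1 (iv)(e) is rendered by the reading spelled out above ([FrdI] Prop. 5.6's
"restricting `P`, `F` to `A`"); no statement of §4 beyond abc-iut-L6-t12's Prop. 4.2 (i)(ii) is proved.
-/

noncomputable section

namespace Literature.AnabelianGeometry.EtaleTheta

open CategoryTheory Opposite Literature.AlgebraicGeometry.Frobenioids

universe u₀ v₀ u v w

namespace TemperedFrobenioid

variable {D₀ : Type u₀} [Category.{v₀} D₀] {V : FrdIMonoidStub.{w}}
  {T : RealifiedDivisorMonoids (D₀ := D₀) V} {D : Type u} [Category.{v} D]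
  {VD : FrdICatStub.{u, v, w} D} (C : TemperedFrobenioid T D VD)

/-- **Definition 4.1 (iv)(e) for the model Frobenioid** (p.313 (PDF p.87)): "`G, α', α''` arise from a
base-Frobenius pair of `C` [cf. Theorem 3.7, (i); [FrdI], Proposition 5.6]" — there is a base-Frobenius
pair `(P, F)` of `C` ([FrdI] Def. 2.7 (iii): `P` a base-section, `F : ℕ_{≥1} → End(P ↪ C)` a
`P`-Frobenius-section) such that every element of `G ⊆ Aut_C(A)` is `P`-distinguished (i.e. lies in the
image of the section `σ : Aut_D(A_D) ↪ Aut_C(A)` of [FrdI] Prop. 5.6 "determined by 'restricting' `P` …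
to `A`"), `α' : A → B` is `P`-distinguished, and `α'' : A → A` is `F`-distinguished (`α'' = F(n)_A`,
the `φ(n)` of [FrdI] Prop. 5.6).  Over abc-iut-L1-t2's `PreFrobenioid.IsBaseFrobeniusPair`.
[cite: MochizukiEtTh2009, Def 4.1 p.313 (PDF p.87)] -/
def ArisesFromBaseFrobeniusPair {A B : C.category} (G : Subgroup (Aut A)) (α₂ : A ⟶ A)
    (α₁ : A ⟶ B) : Prop :=
  ∃ (P : Presection C.category) (Fr : ℕ+ →* End P.ι),
    PreFrobenioid.IsBaseFrobeniusPair C.toElem P Fr ∧ (∀ γ ∈ G, P.hom γ.hom) ∧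
      PreFrobenioid.IsDistinguished P α₁ ∧ PreFrobenioid.IsFDistinguished P Fr α₂

/-- If `G, α', α''` arise from the base-Frobenius pair `(P, F)`, then `A ∈ Ob(P)` ([FrdI] Prop. 5.6:
"`A ∈ Ob(P)` a Frobenius-trivial object"). [cite: MochizukiEtTh2009, Def 4.1 p.313 (PDF p.87)] -/
theorem ArisesFromBaseFrobeniusPair.exists_obj {A B : C.category} {G : Subgroup (Aut A)} {α₂ : A ⟶ A}
    {α₁ : A ⟶ B} (h : C.ArisesFromBaseFrobeniusPair G α₂ α₁) :
    ∃ (P : Presection C.category) (Fr : ℕ+ →* End P.ι),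
      PreFrobenioid.IsBaseFrobeniusPair C.toElem P Fr ∧ P.obj A ∧ P.obj B := by
  obtain ⟨P, Fr, hPF, -, h₁, -⟩ := h
  exact ⟨P, Fr, hPF, (P.obj_of_hom α₁ h₁).1, (P.obj_of_hom α₁ h₁).2⟩

/-- In particular `C` is then of pre-model type ([FrdI] Def. 2.7 (iii)) — cf. [EtTh] Thm. 3.7 (i) "`C`
is of … model … type". [cite: MochizukiEtTh2009, Def 4.1 p.313 (PDF p.87)] -/
theorem ArisesFromBaseFrobeniusPair.isOfPreModelType {A B : C.category} {G : Subgroup (Aut A)}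
    {α₂ : A ⟶ A} {α₁ : A ⟶ B} (h : C.ArisesFromBaseFrobeniusPair G α₂ α₁) :
    PreFrobenioid.IsOfPreModelType C.toElem := by
  obtain ⟨P, Fr, hPF, -, -, -⟩ := h
  exact ⟨P, Fr, hPF⟩

end TemperedFrobenioid

namespace BiKummerSetting

variable {K : Type u₀} [Field K] (X : SemiGraphs.TemperedArithmeticGroup.{u₀} K) {D₀ : Type u₀}
  [Category.{v₀} D₀] {V : FrdIMonoidStub.{w}} {T : RealifiedDivisorMonoids (D₀ := D₀) V}
  {D : Type u} [Category.{v} D] {VD : FrdICatStub.{u, v, w} D}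

/-- **The canonical model instance of the §4 setting**: `mkOfModel` (birational vocabulary from the
model Frobenioid, [FrdI] Thm. 5.2 (ii)) with, moreover, "disjoint supports" := the [FrdI] Prop. 4.1 (iii)
predicate `∀ x, x ∣ a → x ∣ b → x = 1` (Def. 4.1 (i)) and "arise from a base-Frobenius pair" :=
`TemperedFrobenioid.ArisesFromBaseFrobeniusPair` (Def. 4.1 (iv)(e)).  Remaining arguments: the
tempered Frobenioid `tf` with monoid type `ℤ` and `Φ` perfect, the Galois
objects of `D` with `Π^tp_X ↠ Aut_D(−)` (`TODO-merge(abc-iut-L3-t2)`), `(N, H)`-saturation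
(`TODO-merge(abc-iut-L1-t4)`), and `A_⊙`. [cite: MochizukiEtTh2009, Def 4.1 p.312 (PDF p.86)] -/
def mkOfModelCanonical (tf : TemperedFrobenioid T D VD) (monoidType_eq : tf.monoidType = MonoidType.Z)
    (isPerfect : ∀ A : Dᵒᵖ, IsPerfect (tf.Φ.carrier A))
    (IsGaloisObj : D → Prop) (galoisSurj : ∀ A : D, IsGaloisObj A → (X.Pi →* Aut A))
    (galoisSurj_surjective : ∀ (A : D) (h : IsGaloisObj A), Function.Surjective (galoisSurj A h))
    (IsNHSaturatedBsFld : Subgroup (Field.absoluteGaloisGroup K) → tf.category → ℕ+ → Prop)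
    (Aodot : tf.category) (isFrobeniusTrivial_Aodot : PreFrobenioid.IsFrobeniusTrivial tf.toElem Aodot)
    (isGalois_Aodot : IsGaloisObj Aodot.base) : BiKummerSetting X T D VD :=
  mkOfModel X tf monoidType_eq isPerfect T.isUnit_BΛ
    (fun {A} a b => ∀ x : tf.Φ.carrier A, x ∣ a → x ∣ b → x = 1) IsGaloisObj galoisSurj
    galoisSurj_surjective IsNHSaturatedBsFld
    (fun {_ _} G α₂ α₁ => tf.ArisesFromBaseFrobeniusPair G α₂ α₁)
    Aodot isFrobeniusTrivial_Aodot isGalois_Aodot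

variable (tf : TemperedFrobenioid T D VD) (hZ : tf.monoidType = MonoidType.Z)
  (hP : ∀ A : Dᵒᵖ, IsPerfect (tf.Φ.carrier A)) (IG : D → Prop) (gS : ∀ A : D, IG A → (X.Pi →* Aut A))
  (gSs : ∀ (A : D) (h : IG A), Function.Surjective (gS A h))
  (NH : Subgroup (Field.absoluteGaloisGroup K) → tf.category → ℕ+ → Prop) (A₀ : tf.category)
  (hA₀ : PreFrobenioid.IsFrobeniusTrivial tf.toElem A₀) (hA₀' : IG A₀.base)

/-- The disjoint-supports predicate of the canonical instance is the [FrdI] Prop. 4.1 (iii) predicate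
(definitionally). [cite: MochizukiEtTh2009, Def 4.1 p.312 (PDF p.86)] -/
theorem mkOfModelCanonical_disjointSupports {A : Dᵒᵖ} (a b : tf.Φ.carrier A) :
    (mkOfModelCanonical X tf hZ hP IG gS gSs NH A₀ hA₀ hA₀').DisjointSupports a b ↔
      ∀ x : tf.Φ.carrier A, x ∣ a → x ∣ b → x = 1 :=
  Iff.rfl

/-- The "arise from a base-Frobenius pair" predicate of the canonical instance is
`TemperedFrobenioid.ArisesFromBaseFrobeniusPair` (definitionally).
[cite: MochizukiEtTh2009, Def 4.1 p.313 (PDF p.87)] -/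
theorem mkOfModelCanonical_arisesFromBaseFrobeniusPair {A B : tf.category} (G : Subgroup (Aut A))
    (α₂ : A ⟶ A) (α₁ : A ⟶ B) :
    (mkOfModelCanonical X tf hZ hP IG gS gSs NH A₀ hA₀ hA₀').ArisesFromBaseFrobeniusPair
        G α₂ α₁ ↔ tf.ArisesFromBaseFrobeniusPair G α₂ α₁ :=
  Iff.rfl

/-- The underlying tempered Frobenioid of the canonical instance is `tf` (definitionally).
[cite: MochizukiEtTh2009, Def 4.1 p.312 (PDF p.86)] -/
theorem mkOfModelCanonical_tf :
    (mkOfModelCanonical X tf hZ hP IG gS gSs NH A₀ hA₀ hA₀').tf = tf :=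
  rfl

/-- **[EtTh] Prop. 4.2 (i) for the canonical model instance** — abc-iut-L6-t12's
`prop42_i_mkOfModel_coprime` (the cancellation law of [FrdI] Prop. 4.1 (iii) is a theorem), assuming only
that every `Φ(A)` is perf-factorial in the tree's sense.
[cite: MochizukiEtTh2009, Prop 4.2 p.314 (PDF p.88)] -/
theorem prop42_i_mkOfModelCanonical (hpf : ∀ A : Dᵒᵖ, IsPerfFactorial (tf.Φ.carrier A)) :
    (mkOfModelCanonical X tf hZ hP IG gS gSs NH A₀ hA₀ hA₀').Prop42_i :=
  prop42_i_mkOfModel_coprime X tf hZ hP T.isUnit_BΛ IG gS gSs NH _ A₀ hA₀ hA₀' hpf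

/-- **[EtTh] Prop. 4.2 (ii) for the canonical model instance** (necessity and uniqueness, as typed) —
abc-iut-L6-t12's `prop42_ii_mkOfModel_coprime`. [cite: MochizukiEtTh2009, Prop 4.2 p.314 (PDF p.88)] -/
theorem prop42_ii_mkOfModelCanonical (hpf : ∀ A : Dᵒᵖ, IsPerfFactorial (tf.Φ.carrier A)) :
    (mkOfModelCanonical X tf hZ hP IG gS gSs NH A₀ hA₀ hA₀').Prop42_ii :=
  prop42_ii_mkOfModel_coprime X tf hZ hP T.isUnit_BΛ IG gS gSs NH _ A₀ hA₀ hA₀' hpf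

end BiKummerSetting

end Literature.AnabelianGeometry.EtaleTheta

end
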